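import Literature.Probability.RandomPlanarGeometry.SAWReflect
import HarnessLib

/-!
# Self-avoiding walks on `ℤ^d`: level profiles, the last top visit, and the strict cut it creates

Second infrastructure layer for O'Brien's monotonicity theorem `cₙ ≤ cₙ₊₁` (named fact
`BDGS2012_count_mono`; O'Brien, J. Stat. Phys. **59** (1990) 969–979), on top of
`SAWReflect.lean` (`reflectTail k c T ω`, the half-step unfolding of the tail `ω[T, n]` in the
hyperplane `x_k = c/2`, valid at every visit `T` of the top hyperplane with `c = 2M + 1`).

Every injection `SAW_n → SAW_{n+1}` built from such unfoldings has to be DECODED from the image,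
and the decoding handle is the LEVEL PROFILE `i ↦ ω(i)_k`.  This file proves the three profile
facts on which any such decoder rests (Madras–Slade 1993 §3.1 unfolding; the "cut" language is
that of Hammersley–Welsh bridges, Madras–Slade §1.2 and §3.1):

* `saws_apply_add_two_ne`, `saws_level_ne_of_up`, `saws_level_ne_of_down` — a self-avoiding walk
  never reverses a step, so its level profile is REVERSAL-FREE: an up-step in coordinate `k` is
  never immediately followed by a down-step in coordinate `k` (and vice versa);
* `lastTopVisit k ω n` — the last time `T ≤ n` at which the level `ω(T)_k` is maximal on `[0, n]`
  (`lastTopVisit_le`, `level_le_lastTopVisit`, `level_lt_of_lastTopVisit_lt`), and the reversal-free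
  consequence `level_pred_lastTopVisit` (the top level is entered by a flat step: `ω(T-1)_k = M`
  whenever `1 ≤ T ≤ n - 1`);
* for the unfolding `μ = reflectTail k (2M+1) T ω` at `T = lastTopVisit k ω n`, `M = ω(T)_k`:
  the head has levels `≤ M` (`level_reflectTail_head_le`), the new vertex has level `M + 1`
  (`level_reflectTail_lastTopVisit_succ`) and everything after it has level `≥ M + 2`
  (`level_reflectTail_tail_ge`): the time `T + 1` is a STRICT UP-CUT of the image (its level is
  visited exactly once, everything before is lower, everything after is higher) —
  `reflectTail_lastTopVisit_strictCut`.

Nothing here is specific to a choice rule; no named facts are introduced.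

## References
* N. Madras, G. Slade, *The Self-Avoiding Walk*, Birkhäuser 1993, §1.2 (bridges, cut times),
  §3.1 (unfolding), §7.1 p. 231 (O'Brien's theorem).
* G. L. O'Brien, Monotonicity of the number of self-avoiding walks, J. Stat. Phys. 59 (1990).
-/

noncomputable section

open Finset Literature.Probability.LatticeModels Literature.Probability.Percolation SimpleGraph
open scoped BigOperators

namespace Literature.Probability.RandomPlanarGeometry.SAW.Zd

variable {d : ℕ}

/-! ### One step changes one level by one; no immediate reversals -/

/-- A lattice step that raises the `k`-th coordinate is the step `+e_k`. [folklore] -/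
theorem eq_add_single_of_adj {x y : Site d} {k : Fin d} (h : (zdGraph d).Adj x y)
    (hk : y k = x k + 1) : y = x + Pi.single k 1 := by
  obtain ⟨i, hi | hi⟩ := (zdGraph_adj_iff x y).1 h
  · by_cases hik : i = k
    · subst hik; exact hi
    · have := congrFun hi k
      simp [Pi.single_eq_of_ne (Ne.symm hik)] at this
      omega
  · have := congrFun hi k
    by_cases hik : i = k
    · subst hik; simp at this; omega
    · simp [Pi.single_eq_of_ne (Ne.symm hik)] at this; omega

/-- A lattice step that lowers the `k`-th coordinate is the step `-e_k`. [folklore] -/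
theorem eq_add_single_of_adj' {x y : Site d} {k : Fin d} (h : (zdGraph d).Adj x y)
    (hk : y k = x k - 1) : x = y + Pi.single k 1 :=
  eq_add_single_of_adj h.symm (by omega)

/-- A self-avoiding walk never returns to a site two steps later ("no immediate reversal").
[folklore] -/
theorem saws_apply_add_two_ne {n i : ℕ} {ω : ℕ → Site d} (hω : ω ∈ saws d n) (hi : i + 2 ≤ n) :
    ω (i + 2) ≠ ω i := by
  intro h
  have hinj := (mem_saws.1 hω).2.2.2
  have := hinj (show i + 2 ∈ {j | j ≤ n} by simpa using hi)
    (show i ∈ {j | j ≤ n} by simp only [Set.mem_setOf_eq]; omega) h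
  omega

/-- The level profile `i ↦ ω(i)_k` of a self-avoiding walk is reversal-free: an up-step in
coordinate `k` is not immediately followed by a down-step in coordinate `k`. [folklore] -/
theorem saws_level_ne_of_up {n i : ℕ} {ω : ℕ → Site d} {k : Fin d} (hω : ω ∈ saws d n)
    (hi : i + 2 ≤ n) (h1 : ω (i + 1) k = ω i k + 1) : ω (i + 2) k ≠ ω i k := by
  intro h2
  have hadj := (mem_saws.1 hω).2.2.1
  have e1 : ω (i + 1) = ω i + Pi.single k 1 := eq_add_single_of_adj (hadj i (by omega)) h1
  have e2 : ω (i + 1) = ω (i + 2) + Pi.single k 1 :=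
    eq_add_single_of_adj' (hadj (i + 1) (by omega)) (by rw [h2, h1]; ring)
  exact saws_apply_add_two_ne hω hi (add_right_cancel (e2.symm.trans e1))

/-- Reversal-freeness, downward version: a down-step in coordinate `k` is not immediately followed
by an up-step in coordinate `k`. [folklore] -/
theorem saws_level_ne_of_down {n i : ℕ} {ω : ℕ → Site d} {k : Fin d} (hω : ω ∈ saws d n)
    (hi : i + 2 ≤ n) (h1 : ω (i + 1) k = ω i k - 1) : ω (i + 2) k ≠ ω i k := by
  intro h2
  have hadj := (mem_saws.1 hω).2.2.1
  have e1 : ω i = ω (i + 1) + Pi.single k 1 := eq_add_single_of_adj' (hadj i (by omega)) h1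
  have e2 : ω (i + 2) = ω (i + 1) + Pi.single k 1 :=
    eq_add_single_of_adj (hadj (i + 1) (by omega)) (by rw [h2, h1]; ring)
  exact saws_apply_add_two_ne hω hi (e2.trans e1.symm)

/-- Consecutive levels of a walk differ by at most one. [folklore] -/
theorem saws_level_succ_le {n i : ℕ} {ω : ℕ → Site d} (k : Fin d) (hω : ω ∈ saws d n) (hi : i < n) :
    ω (i + 1) k ≤ ω i k + 1 ∧ ω i k ≤ ω (i + 1) k + 1 := by
  have h := abs_sub_le_one_of_adj ((mem_saws.1 hω).2.2.1 i hi) k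
  rw [abs_le] at h
  constructor <;> linarith [h.1, h.2]

/-! ### The last visit of the top hyperplane -/

open Classical in
/-- `lastTopVisit k ω n`: the last time `T ∈ [0, n]` at which the level `ω(T)_k` is maximal over
`[0, n]` — the last visit of the walk to its top hyperplane `x_k = M` (for `k = 0` this is the
`n₁(ω)` of the Hammersley–Welsh unfolding, `lastArgmax n ω` of `SAWUnfoldingStep.lean`; here the
coordinate is a parameter, matching `reflectTail k`). [folklore] -/
def lastTopVisit (k : Fin d) (ω : ℕ → Site d) (n : ℕ) : ℕ :=
  Nat.findGreatest (fun T => ∀ i ≤ n, ω i k ≤ ω T k) n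

variable (k : Fin d) (ω : ℕ → Site d) (n : ℕ)

/-- The last top visit happens no later than `n`. [folklore] -/
theorem lastTopVisit_le : lastTopVisit k ω n ≤ n := by
  classical
  unfold lastTopVisit
  convert Nat.findGreatest_le (P := fun T => ∀ i ≤ n, ω i k ≤ ω T k) n

/-- The level at the last top visit is the maximal level `M` on `[0, n]`. [folklore] -/
theorem level_le_lastTopVisit {i : ℕ} (hi : i ≤ n) : ω i k ≤ ω (lastTopVisit k ω n) k := by
  classical
  obtain ⟨T, hT, hmax⟩ := exists_isMax_level k ω n
  have h := Nat.findGreatest_spec (P := fun T => ∀ i ≤ n, ω i k ≤ ω T k) hT hmax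
  unfold lastTopVisit
  convert h i hi

/-- After the last top visit the level is strictly below `M`. [folklore] -/
theorem level_lt_of_lastTopVisit_lt {i : ℕ} (h : lastTopVisit k ω n < i) (hi : i ≤ n) :
    ω i k < ω (lastTopVisit k ω n) k := by
  classical
  have hnot : ¬ ∀ j ≤ n, ω j k ≤ ω i k := by
    have := Nat.findGreatest_is_greatest (P := fun T => ∀ j ≤ n, ω j k ≤ ω T k)
      (by unfold lastTopVisit at h; convert h) hi
    convert this
  push Not at hnot
  obtain ⟨j, hj, hlt⟩ := hnot
  exact lt_of_lt_of_le hlt (level_le_lastTopVisit k ω n hj)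

variable {k ω n}

/-- **The top level is entered flat.** If the last top visit `T` of a self-avoiding walk satisfies
`1 ≤ T ≤ n - 1`, then `ω(T-1)_k = M`: indeed `ω(T+1)_k = M - 1` (strictly below the maximum and
adjacent), and `ω(T-1)_k = M - 1` would be an immediate reversal in coordinate `k`.  (This is why
the unfolding at the last top visit always has a reversal-free — i.e. realisable — preimage.)
[folklore] -/
theorem level_pred_lastTopVisit (hω : ω ∈ saws d n) {T : ℕ} (hT : lastTopVisit k ω n = T)
    (h1 : 1 ≤ T) (h2 : T + 1 ≤ n) : ω (T - 1) k = ω T k := by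
  have hlt : ω (T + 1) k < ω T k := by
    have := level_lt_of_lastTopVisit_lt k ω n (i := T + 1) (by omega) h2
    rwa [hT] at this
  have hle2 := (saws_level_succ_le k hω (show T < n by omega)).2
  have hafter : ω (T + 1) k = ω T k - 1 := by omega
  have hbefore : ω (T - 1) k ≤ ω T k := by
    have := level_le_lastTopVisit k ω n (show T - 1 ≤ n by omega)
    rwa [hT] at this
  have hstep := (saws_level_succ_le k hω (show T - 1 < n by omega)).1
  rw [Nat.sub_add_cancel h1] at hstep
  -- so `ω (T-1) k ∈ {M-1, M}`; the value `M-1` would be an immediate reversal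
  by_contra hne
  have hdown : ω T k = ω (T - 1) k + 1 := by omega
  have key := saws_level_ne_of_up (i := T - 1) hω (by omega)
    (by rw [Nat.sub_add_cancel h1]; exact hdown)
  rw [show T - 1 + 2 = T + 1 by omega] at key
  omega

/-! ### The strict cut created by unfolding at the last top visit -/

/-- Head of the unfolding: up to time `T` the levels are at most `M`. [cite: MadrasSlade1993, §3.1] -/
theorem level_reflectTail_head_le {c : ℤ} {T i : ℕ} (hT : T = lastTopVisit k ω n) (hi : i ≤ T) :
    reflectTail k c T ω i k ≤ ω (lastTopVisit k ω n) k := by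
  rw [reflectTail_apply_of_le k c T ω hi]
  exact level_le_lastTopVisit k ω n (by have := lastTopVisit_le k ω n; omega)

/-- The new vertex of the unfolding at a top visit sits at level `M + 1`.
[cite: MadrasSlade1993, §3.1] -/
theorem level_reflectTail_succ_eq (T : ℕ) :
    reflectTail k (2 * ω T k + 1) T ω (T + 1) k = ω T k + 1 := by
  rw [reflectTail_apply_succ, reflAt_apply_same]; ring

/-- Tail of the unfolding at the LAST top visit: from time `T + 2` on the levels are at least
`M + 2` (the old tail was strictly below `M`). [cite: MadrasSlade1993, §3.1] -/
theorem level_reflectTail_tail_ge {T i : ℕ} (hT : T = lastTopVisit k ω n) (hi : T + 2 ≤ i)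
    (hin : i ≤ n + 1) :
    ω (lastTopVisit k ω n) k + 2 ≤ reflectTail k (2 * ω T k + 1) T ω i k := by
  rw [reflectTail_apply_of_lt_level k _ T ω (show T < i by omega)]
  have := level_lt_of_lastTopVisit_lt k ω n (i := i - 1) (by omega) (by omega)
  subst hT
  omega

/-- **The unfolding at the last top visit creates a strict up-cut.**  With `T = lastTopVisit k ω n`,
`M = ω(T)_k` and `μ = reflectTail k (2M+1) T ω`: every level of `μ` before time `T + 1` is `< M + 1`,
the level at time `T + 1` is `M + 1`, and every level after it (up to time `n + 1`) is `> M + 1`.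
In particular `M + 1` is visited exactly once by `μ` on `[0, n+1]`, and `T + 1` can be read off
`μ` as the (first = only) visit of that level — the basic decoding handle for injections built
from unfoldings. [cite: MadrasSlade1993, §3.1] -/
theorem reflectTail_lastTopVisit_strictCut {i : ℕ} (hin : i ≤ n + 1) :
    let T := lastTopVisit k ω n
    let μ := reflectTail k (2 * ω T k + 1) T ω
    (i < T + 1 → μ i k < ω T k + 1) ∧ (μ (T + 1) k = ω T k + 1) ∧
      (T + 1 < i → ω T k + 1 < μ i k) := by
  refine ⟨fun hi => ?_, level_reflectTail_succ_eq (k := k) (ω := ω) _, fun hi => ?_⟩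
  · have := level_reflectTail_head_le (k := k) (ω := ω) (n := n) (c := 2 * ω (lastTopVisit k ω n) k + 1)
      (T := lastTopVisit k ω n) rfl (show i ≤ lastTopVisit k ω n by omega)
    omega
  · have := level_reflectTail_tail_ge (k := k) (ω := ω) (n := n) (T := lastTopVisit k ω n) rfl
      (show lastTopVisit k ω n + 2 ≤ i by omega) hin
    omega

/-! ### Folding back: which walks are unfoldings -/

/-- Before the cut, folding does nothing. [folklore] -/
theorem foldTail_apply_of_le (k : Fin d) (c : ℤ) (T : ℕ) (μ : ℕ → Site d) {i : ℕ} (hi : i ≤ T) :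
    foldTail k c T μ i = μ i := by
  simp [foldTail, hi]

/-- After the cut, folding reflects the vertex one time unit later. [folklore] -/
theorem foldTail_apply_of_lt (k : Fin d) (c : ℤ) (T : ℕ) (μ : ℕ → Site d) {i : ℕ} (hi : T < i) :
    foldTail k c T μ i = reflAt k c (μ (i + 1)) := by
  simp [foldTail, Nat.not_le.2 hi]

/-- **Unfoldings are exactly the walks with the right junction step.** If the step of `μ` at time
`T` is `μ(T) → reflAt k c (μ(T))` (for `c = 2 μ(T)_k + 1`: the step `+e_k`), then `μ` is the
unfolding `reflectTail k c T` of its fold `foldTail k c T μ`.  So a decoder that has located the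
cut time `T` (and knows `c`) recovers the unique candidate preimage by folding; whether that
candidate is self-avoiding is a separate matter. [cite: MadrasSlade1993, §3.1] -/
theorem reflectTail_foldTail (k : Fin d) (c : ℤ) (T : ℕ) (μ : ℕ → Site d)
    (h : μ (T + 1) = reflAt k c (μ T)) : reflectTail k c T (foldTail k c T μ) = μ := by
  funext i
  rcases lt_trichotomy i (T + 1) with hi | rfl | hi
  · rw [reflectTail_apply_of_le k c T _ (by omega), foldTail_apply_of_le k c T μ (by omega)]
  · rw [reflectTail_apply_succ, foldTail_apply_of_le k c T μ le_rfl, h]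
  · rw [reflectTail_apply_of_lt k c T _ (by omega), foldTail_apply_of_lt k c T μ (by omega),
      reflAt_reflAt, Nat.sub_add_cancel (by omega)]

/-- Two unfoldings with the same parameters and the same image come from the same walk (this is
`reflectTail_injective`, restated as the form used by decoders: equal codes ⇒ equal sources).
[folklore] -/
theorem eq_of_reflectTail_eq {k : Fin d} {c₁ c₂ : ℤ} {T₁ T₂ : ℕ} {ω₁ ω₂ : ℕ → Site d}
    (hc : c₁ = c₂) (hT : T₁ = T₂) (h : reflectTail k c₁ T₁ ω₁ = reflectTail k c₂ T₂ ω₂) :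
    ω₁ = ω₂ := by
  subst hc; subst hT
  exact reflectTail_injective k c₁ T₁ h

end Literature.Probability.RandomPlanarGeometry.SAW.Zd
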